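import Mathlib
import HarnessLib.Audit
import Summits.PneNP.PneNP.Theorems.PstarGateCaseTTouch
import Summits.PneNP.PneNP.Theorems.PstarGateCaseTOffQ
import Summits.PneNP.PneNP.Theorems.PstarGateCaseTLocal
import Summits.PneNP.PneNP.Theorems.PstarGateFibreRank
import Summits.PneNP.PneNP.Theorems.PstarRankRigidity

/-!
# One GATED chord, CASE T at rank six: every other cycle is the gated one flipped on the chamber, and `q` is pinned (E2; prover-1 g19)

FRONTIER range-avoidance ladder, rung F-N3 (`stmt-PneNP-19007`), cell `pnp-ideate` (`PstarGateNodesX`, nodes N3/N4); restricted-model proof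
complexity — nothing here bears on `P` versus `NP`.

CASE T (other chords read along one transverse `mv`, all read), one gate of coefficient `κ₀ + x_u`, chamber `H₁ = {x_u = κ₀ + 1}`, `W = {x_u = 0}`.
If `Q_{D e}` has rank `≥ 6` on `W`, rigidity (`PstarRankRigidity.eq_zero_or_eq_of_rank_six`) applied to the chamber separation
(`PstarGateCaseTTouch.caseT_force`: `u_e = 0 ⟹ u_{e'} = 1` on `H₁`) and to the OFF-region pin of `q_{(1,0)}` (`PstarGateCaseTOffQ.caseT_off_q`)
gives, for EVERY other chord `e'`:

* `caseT_six_coupled` — `u_{e'} = u_e + 1` on `H₁` (the alternative `u_{e'} ≡ 1` on `H₁` would empty `avoid (D e') {u}`);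
* `caseT_six_kappa` / `caseT_six_through` — hence `κ₀ = 1` and every edge of `D e ∆ D e'` passes through `u` (`const_on_hyperplane`);
* `caseT_six_q` — and `q_{(1,0)} ≡ σ₀ + 1` on `H₁` or `q_{(1,0)} = u_e + σ₀ + 1` on `H₁` (`σ₀` = number of private reads of the other chords).
-/

set_option linter.dupNamespace false -- `Summit.PneNP.PneNP.…`: summit = sub-problem name (D-0017 single-conjunct layout)

open Finset Module Literature.Computability.Complexity
open scoped symmDiff
open Summit.PneNP.PneNP.Theorems.PstarTyped (Typed)
open Summit.PneNP.PneNP.Theorems.PstarSALevel (SimpleOverlap)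
open Summit.PneNP.PneNP.Theorems.PstarCubeIdeals (IsQuadFn)
open Summit.PneNP.PneNP.Theorems.PstarRankRigidity (eq_zero_or_eq_of_rank_six)
open Summit.PneNP.PneNP.Theorems.PstarProductRank (qform polar)
open Summit.PneNP.PneNP.Theorems.PstarQuadRank (rad)
open Summit.PneNP.PneNP.Theorems.PstarQuadRestrict (quad_restrict)
open Summit.PneNP.PneNP.Theorems.PstarPathRankFibre (coordKer mem_coordKer avoid)
open Summit.PneNP.PneNP.Theorems.PstarReadSumset (V2)
open Summit.PneNP.PneNP.Theorems.PstarChordSystem (ChordSystem)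
open Summit.PneNP.PneNP.Theorems.PstarChordBridgeTools (privs coef)
open Summit.PneNP.PneNP.Theorems.PstarChordBridge (BridgeData sys Solution Lift)
open Summit.PneNP.PneNP.Theorems.PstarChordBridgeForcing (gam sys_u_eq)
open Summit.PneNP.PneNP.Theorems.PstarChordBridgeBasis (qDir polarDir)
open Summit.PneNP.PneNP.Theorems.PstarChordBridgeCorner (qDir_add)
open Summit.PneNP.PneNP.Theorems.PstarChordBridgeFundamental (eq_of_fundamental_eq)
open Summit.PneNP.PneNP.Theorems.PstarGateBridge (GateHyp const_of_others)
open Summit.PneNP.PneNP.Theorems.PstarGateHyperplane (const_on_hyperplane)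
open Summit.PneNP.PneNP.Theorems.PstarGateCaseTLocal (u_add)
open Summit.PneNP.PneNP.Theorems.PstarGateFibreRank (avoid_nonempty)
open Summit.PneNP.PneNP.Theorems.PstarGateNodes (GateData)
open Summit.PneNP.PneNP.Theorems.PstarGateNodesX (GateDataX)
open Summit.PneNP.PneNP.Theorems.PstarGateCaseTTouch (caseT_force)
open Summit.PneNP.PneNP.Theorems.PstarGateCaseTOffQ (caseT_off_q)

namespace Summit.PneNP.PneNP.Theorems.PstarGateCaseTRankSix

variable {n m : ℕ}

/-- From a chamber statement on `x₀ + W` to the hyperplane `{x_u = c}`. -/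
theorem of_chamber {u : Fin n} {c : ZMod 2} {S : (Fin n → ZMod 2) → Prop}
    (h : ∀ w : coordKer ({u} : Finset (Fin n)), S ((Pi.single u c : Fin n → ZMod 2) + (w : Fin n → ZMod 2))) :
    ∀ x : Fin n → ZMod 2, x u = c → S x := by
  intro x hx
  have hw : x + Pi.single u c ∈ coordKer ({u} : Finset (Fin n)) := by
    rw [mem_coordKer]
    intro w hw
    rw [mem_singleton] at hw
    subst hw
    rw [Pi.add_apply, hx, Pi.single_eq_same, CharTwo.add_self_eq_zero]
  have h' := h ⟨x + Pi.single u c, hw⟩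
  have hxx : (Pi.single u c : Fin n → ZMod 2) + (x + Pi.single u c) = x := by
    ext v
    rw [Pi.add_apply, Pi.add_apply, add_comm (x v), ← add_assoc, CharTwo.add_self_eq_zero, zero_add]
  simpa only [hxx] using h'

/-- The number (mod 2) of private reads of the chords other than `e`, at the origin. -/
theorem sigma_const (I : LocalMap 4 n m) {B : BridgeData n m} (hW : B.WF I) {e : Fin m} (hG : GateHyp I B e) (x : Fin n → ZMod 2) :
    ∑ i ∈ B.N.erase e, (((sys I B).ρ i x).2 + ((sys I B).ρ' i x).2) = ∑ i ∈ B.N.erase e, (((sys I B).ρ i 0).2 + ((sys I B).ρ' i 0).2) := by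
  refine sum_congr rfl fun i hi => ?_
  obtain ⟨hne, hiN⟩ := mem_erase.1 hi
  obtain ⟨h1, h2⟩ := const_of_others I hW hG i hiN hne x 0
  rw [h1, h2]

section RankSix

variable (I : LocalMap 4 n m) (hI : I.IsPure xorAndPred) (hT : Typed I) (hS : SimpleOverlap I) {r₀ : ℕ} {B : BridgeData n m}
  {e g₀ : Fin m} {u : Fin n} {κ₀ : ZMod 2} (hD : GateDataX I r₀ B e g₀ u κ₀) {mv : V2} (hmvT : mv = (0, 1) ∨ mv = (1, 1))
  (hP : ∀ e' ∈ B.N, e' ≠ e → ∀ a, ((sys I B).ρ e' a = 0 ∨ (sys I B).ρ e' a = mv) ∧ ((sys I B).ρ' e' a = 0 ∨ (sys I B).ρ' e' a = mv))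
  (hread : ∀ e' ∈ B.N, e' ≠ e → ∀ a, (sys I B).ρ e' a ≠ 0 ∨ (sys I B).ρ' e' a ≠ 0)
  (h6 : finrank (ZMod 2) (rad ((polar (B.D e) (fun j => I.vars j 2) (fun j => I.vars j 3)).restrict (coordKer ({u} : Finset (Fin n))))) + 6 ≤
    finrank (ZMod 2) (coordKer ({u} : Finset (Fin n))))
include hI hT hS hD hmvT hP hread h6

/-- **Rank six: every other cycle is the gated one flipped on the chamber.** -/
theorem caseT_six_coupled {e' : Fin m} (he' : e' ∈ B.N) (hne : e' ≠ e) :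
    ∀ x : Fin n → ZMod 2, x u = κ₀ + 1 → (sys I B).u e' x = (sys I B).u e x + 1 := by
  classical
  obtain ⟨-, hW, -⟩ := id hD
  have he'D : e' ∉ B.D e' := fun h => (mem_sdiff.1 (hW.hD e' he' h)).2 he'
  set W : Submodule (ZMod 2) (Fin n → ZMod 2) := coordKer ({u} : Finset (Fin n)) with hWdef
  set x₀ : Fin n → ZMod 2 := Pi.single u (κ₀ + 1) with hx₀
  set P : W → ZMod 2 := fun w => (sys I B).u e (x₀ + (w : Fin n → ZMod 2)) with hPdef
  set g : W → ZMod 2 := fun w => (sys I B).u e' (x₀ + (w : Fin n → ZMod 2)) + 1 with hgdef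
  have hPq : ∀ v w : W, P (v + w) = P v + P w + P 0 +
      ((polar (B.D e) (fun j => I.vars j 2) (fun j => I.vars j 3)).restrict W) v w := quad_restrict (u_add I B e) W x₀
  have hP' : ∀ v w : W, (sys I B).u e' (x₀ + ((v + w : W) : Fin n → ZMod 2)) = (sys I B).u e' (x₀ + (v : Fin n → ZMod 2)) +
      (sys I B).u e' (x₀ + (w : Fin n → ZMod 2)) + (sys I B).u e' (x₀ + ((0 : W) : Fin n → ZMod 2)) +
      ((polar (B.D e') (fun j => I.vars j 2) (fun j => I.vars j 3)).restrict W) v w := quad_restrict (u_add I B e') W x₀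
  have hg : IsQuadFn g := by
    refine ⟨(polar (B.D e') (fun j => I.vars j 2) (fun j => I.vars j 3)).restrict W, fun v w => ?_⟩
    show (sys I B).u e' (x₀ + ((v + w : W) : Fin n → ZMod 2)) + 1 = (sys I B).u e' (x₀ + (v : Fin n → ZMod 2)) + 1 +
      ((sys I B).u e' (x₀ + (w : Fin n → ZMod 2)) + 1) + ((sys I B).u e' (x₀ + ((0 : W) : Fin n → ZMod 2)) + 1) +
      ((polar (B.D e') (fun j => I.vars j 2) (fun j => I.vars j 3)).restrict W) v w
    rw [hP' v w]
    generalize (sys I B).u e' (x₀ + (v : Fin n → ZMod 2)) = a; generalize (sys I B).u e' (x₀ + (w : Fin n → ZMod 2)) = b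
    generalize (sys I B).u e' (x₀ + ((0 : W) : Fin n → ZMod 2)) = c
    generalize ((polar (B.D e') (fun j => I.vars j 2) (fun j => I.vars j 3)).restrict W) v w = s
    revert a b c s; decide
  have hforce := caseT_force I hI hT hD hmvT he' hne (hP e' he' hne) (hread e' he' hne)
  have hwu : ∀ w : W, (x₀ + (w : Fin n → ZMod 2)) u = κ₀ + 1 := fun w => by
    rw [Pi.add_apply, hx₀, Pi.single_eq_same, (mem_coordKer.1 w.2) u (mem_singleton_self u), add_zero]
  have hZ : ∀ w, P w = 0 → g w = 0 := by
    intro w hw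
    show (sys I B).u e' (x₀ + (w : Fin n → ZMod 2)) + 1 = 0
    rw [hforce _ (hwu w) hw]; decide
  rcases eq_zero_or_eq_of_rank_six hPq h6 hg hZ with h0 | hq
  · exfalso
    have hc : ∀ x : Fin n → ZMod 2, x u = κ₀ + 1 → qform (B.D e') (fun j => I.vars j 2) (fun j => I.vars j 3) x = gam B e' + 1 := by
      refine of_chamber (S := fun x => qform (B.D e') (fun j => I.vars j 2) (fun j => I.vars j 3) x = gam B e' + 1) fun w => ?_
      have h := h0 w
      simp only [hgdef, sys_u_eq] at h
      have e2 : ∀ a Q : ZMod 2, a + Q + 1 = 0 → Q = a + 1 := by decide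
      exact e2 _ _ h
    have hthrough := (const_on_hyperplane I hI hS (B.D e') u (κ₀ + 1) _ hc).1
    obtain ⟨j, hj⟩ := avoid_nonempty I hI hS he'D (hW.hDeven e' he') u
    unfold PstarPathRankFibre.avoid at hj
    obtain ⟨hjD, h2, h3⟩ := mem_filter.1 hj
    rw [mem_singleton] at h2 h3
    rcases hthrough j hjD with h | h
    · exact h2 h
    · exact h3 h
  · refine of_chamber (S := fun x => (sys I B).u e' x = (sys I B).u e x + 1) fun w => ?_
    have h := hq w
    simp only [hgdef, hPdef] at h
    have e2 : ∀ a b : ZMod 2, a + 1 = b → a = b + 1 := by decide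
    exact e2 _ _ h

/-- **Rank six: the gate polarity is `κ₀ = 1` and every edge of `D e ∆ D e'` passes through `u`.** -/
theorem caseT_six_through {e' : Fin m} (he' : e' ∈ B.N) (hne : e' ≠ e) :
    κ₀ = 1 ∧ ∀ j ∈ B.D e ∆ B.D e', I.vars j 2 = u ∨ I.vars j 3 = u := by
  classical
  have hcpl := caseT_six_coupled I hI hT hS hD hmvT hP hread h6 he' hne
  obtain ⟨-, hW, -, -, -, -, -, -, hG, -⟩ := id hD
  have he : e ∈ B.N := hG.1
  have hconst : ∀ x : Fin n → ZMod 2, x u = κ₀ + 1 →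
      qform (B.D e ∆ B.D e') (fun j => I.vars j 2) (fun j => I.vars j 3) x = 1 + gam B e + gam B e' := by
    intro x hx
    have h := hcpl x hx
    rw [sys_u_eq, sys_u_eq] at h
    rw [PstarChordBridgeKill.qform_symmDiff]
    have e3 : ∀ g Q g' Q' : ZMod 2, g' + Q' = g + Q + 1 → Q + Q' = 1 + g + g' := by decide
    exact e3 _ _ _ _ h
  obtain ⟨hthrough, hone⟩ := const_on_hyperplane I hI hS (B.D e ∆ B.D e') u (κ₀ + 1) _ hconst
  refine ⟨?_, hthrough⟩
  by_contra hκ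
  have hκ0 : κ₀ + 1 = 1 := by
    have e2 : ∀ k : ZMod 2, k ≠ 1 → k + 1 = 1 := by decide
    exact e2 κ₀ hκ
  have hempty := hone hκ0
  have heD : e ∉ B.D e := fun h => (mem_sdiff.1 (hW.hD e he h)).2 he
  have he'D : e' ∉ B.D e := fun h => (mem_sdiff.1 (hW.hD e he h)).2 he'
  have hDD : B.D e = B.D e' := by
    have h := Finset.symmDiff_eq_empty.1 hempty
    exact h
  have hev' : ∀ w, Even (PstarChordBridgeTools.xpdeg I (insert e' (B.D e)) w) := fun w => by rw [hDD]; exact hW.hDeven e' he' w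
  exact hne (eq_of_fundamental_eq I hI hS heD he'D (hW.hDeven e he) hev').symm

omit hS in
/-- **Rank six: `q_{(1,0)}` is pinned on the chamber**, to `σ₀ + 1` or to `u_e + σ₀ + 1`. -/
theorem caseT_six_q :
    (∀ x : Fin n → ZMod 2, x u = κ₀ + 1 → qDir I B (1, 0) x = 1 + ∑ i ∈ B.N.erase e, (((sys I B).ρ i 0).2 + ((sys I B).ρ' i 0).2)) ∨
    (∀ x : Fin n → ZMod 2, x u = κ₀ + 1 →
      qDir I B (1, 0) x = (sys I B).u e x + ∑ i ∈ B.N.erase e, (((sys I B).ρ i 0).2 + ((sys I B).ρ' i 0).2) + 1) := by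
  classical
  obtain ⟨-, hW, -, -, -, -, -, -, hG, -⟩ := id hD
  set σ₀ := ∑ i ∈ B.N.erase e, (((sys I B).ρ i 0).2 + ((sys I B).ρ' i 0).2) with hσ₀
  set W : Submodule (ZMod 2) (Fin n → ZMod 2) := coordKer ({u} : Finset (Fin n)) with hWdef
  set x₀ : Fin n → ZMod 2 := Pi.single u (κ₀ + 1) with hx₀
  set P : W → ZMod 2 := fun w => (sys I B).u e (x₀ + (w : Fin n → ZMod 2)) with hPdef
  set g : W → ZMod 2 := fun w => qDir I B (1, 0) (x₀ + (w : Fin n → ZMod 2)) + σ₀ + 1 with hgdef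
  have hPq : ∀ v w : W, P (v + w) = P v + P w + P 0 +
      ((polar (B.D e) (fun j => I.vars j 2) (fun j => I.vars j 3)).restrict W) v w := quad_restrict (u_add I B e) W x₀
  have hq' : ∀ v w : W, qDir I B (1, 0) (x₀ + ((v + w : W) : Fin n → ZMod 2)) = qDir I B (1, 0) (x₀ + (v : Fin n → ZMod 2)) +
      qDir I B (1, 0) (x₀ + (w : Fin n → ZMod 2)) + qDir I B (1, 0) (x₀ + ((0 : W) : Fin n → ZMod 2)) +
      ((polarDir I B (1, 0)).restrict W) v w := quad_restrict (qDir_add I B (1, 0)) W x₀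
  have hg : IsQuadFn g := by
    refine ⟨(polarDir I B (1, 0)).restrict W, fun v w => ?_⟩
    show qDir I B (1, 0) (x₀ + ((v + w : W) : Fin n → ZMod 2)) + σ₀ + 1 = qDir I B (1, 0) (x₀ + (v : Fin n → ZMod 2)) + σ₀ + 1 +
      (qDir I B (1, 0) (x₀ + (w : Fin n → ZMod 2)) + σ₀ + 1) + (qDir I B (1, 0) (x₀ + ((0 : W) : Fin n → ZMod 2)) + σ₀ + 1) +
      ((polarDir I B (1, 0)).restrict W) v w
    rw [hq' v w]
    generalize qDir I B (1, 0) (x₀ + (v : Fin n → ZMod 2)) = a; generalize qDir I B (1, 0) (x₀ + (w : Fin n → ZMod 2)) = b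
    generalize qDir I B (1, 0) (x₀ + ((0 : W) : Fin n → ZMod 2)) = c
    generalize ((polarDir I B (1, 0)).restrict W) v w = s
    generalize σ₀ = k
    revert a b c s k; decide
  have hwu : ∀ w : W, (x₀ + (w : Fin n → ZMod 2)) u = κ₀ + 1 := fun w => by
    rw [Pi.add_apply, hx₀, Pi.single_eq_same, (mem_coordKer.1 w.2) u (mem_singleton_self u), add_zero]
  have hZ : ∀ w, P w = 0 → g w = 0 := by
    intro w hw
    have h := caseT_off_q I hI hT hD hmvT hP hread (hwu w) hw
    rw [sigma_const I hW hG] at h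
    show qDir I B (1, 0) (x₀ + (w : Fin n → ZMod 2)) + σ₀ + 1 = 0
    rw [h, ← hσ₀]
    generalize σ₀ = k; revert k; decide
  rcases eq_zero_or_eq_of_rank_six hPq h6 hg hZ with h0 | hq
  · left
    refine of_chamber (S := fun x => qDir I B (1, 0) x = 1 + σ₀) fun w => ?_
    have h := h0 w
    simp only [hgdef] at h
    have e2 : ∀ a k : ZMod 2, a + k + 1 = 0 → a = 1 + k := by decide
    exact e2 _ _ h
  · right
    refine of_chamber (S := fun x => qDir I B (1, 0) x = (sys I B).u e x + σ₀ + 1) fun w => ?_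
    have h := hq w
    simp only [hgdef, hPdef] at h
    have e2 : ∀ a k b : ZMod 2, a + k + 1 = b → a = b + k + 1 := by decide
    exact e2 _ _ _ h

end RankSix

end Summit.PneNP.PneNP.Theorems.PstarGateCaseTRankSix
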